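/-
Copyright (c) 2026 the pub-hodgecm-mathlib formalisation cell (harness21).  Seat LD2-p01 (g5), ROAD O («orthogonal copy»): the PIN predicate, 2026-09-02.
-/
import Summits.HodgeConjecture.HodgeConjecture.Theorems.F0LD1ThetaRealisationOfB6
import HarnessLib

-- As in the lineage (★ `F0LD1ThetaRealisationOfB6`): statements over the theta-kernel datum elaborate to very large types; elaborate sequentially.
set_option Elab.async false

/-!
# Crux `HLiu418`, LD lines, ROAD O («orthogonal copy») — the UNITARY-CLASS PIN of theta spans as ONE closed `Prop`: `ThetaSpanPin₂`

Cell hodgecm-mathlib (D-0151), FLOOR 0; crux item `HLiu418` = stmt-HodgeConjecture-24832; LD leaves `Cruxes/HLiu418/Lines/F0_P6LD_StubS1FactsThetaRoad.lean`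
(socket `stub_letter_B6` :716) ∕ `…StubS1bFactsOrganRoad.lean` (:650).  Seat LD2-p01 (g5); chair LD1-plan (g3) CLOSER SPEC 2026-09-02T13:12:07Z (c1).
ONE DEFINITION, NO theorem asserted, NO instance, NO notation, NO `sorry`; `--supports stmt-HodgeConjecture-24832`.

WHAT.  ROAD O (LD1-p01 (g5) memo `F0/P6/LD/LD1-p01/g5/ROAD-O-orthogonal-copy.v1`) replaces the printed realisation letter (B6) [Liu2021, Cor. B.6 (1)] =
[Wu2013, Thm. 5.1] for a HOLOMORPHIC `P` by the orthogonal-copy form of [Liu2021, proof of Cor. B.6 (3)]: the glue ★-candidate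
`F0LD1MeetsOfOrthogonalCopy.meetsThetaLiftFromLine_of_starProjection_ne_zero_of_orthogonalCopy` turns «`pr_P` of a theta class from `⟨a′⟩` is non-zero» into
«`P` MEETS the theta lift from `⟨a′⟩`» given its hypothesis `hPin` — the UNITARY-CLASS PIN «two non-zero closed theta spans `Q̄(a′, ξ′)`, `Q̄(b, ξ″)` both unitarily
equivalent to `P` are EQUAL».  This file NAMES that pin, closed over the curve letters' frame, as the target of the PIN ASSEMBLY (LD1-p01 (g5):
`theorem thetaSpanPin₂_holds : ThetaSpanPin₂` from bricks (δ) ★ p851555, (β), (β-away), (η)(T1)(T2), ★ Hasse, ★ seam transport, ★ organ (I), ★ character pin)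
and as the hypothesis of the organ-(R) CLOSER `F0LD1ThetaRealisationOfOrthogonalCopy.thetaRealisation₂_of_orthogonalCopy (hAP♮) (hIrr) (hPin : ThetaSpanPin₂)`;
both import this file and neither imports the other.

BODY (token discipline).  The binder prefix is the (A₂-P) letter prefix of ★ `F0LD1ThetaRealisationOfB6.thetaRealisation₂_of_B6`'s `hAP` VERBATIM
(`L ι H dV hdV hdV0 t ht g hg`, signature `(1,1)` at `ι`, definite elsewhere, `4 ≤ [L:ℚ]`, cone frame `𝔣`, `μ`, `e₁`, `lam hlam`, weight one, `a χ W σ`, `σ` irreducible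
smooth, `j` injective into `ω(lam, ε_a, χ)_f ∘ (finAdelicCongr … g ht hg)⁻¹`, the pinned transport `ιA`, compact `[U(diag dV)]`, `P` discrete with
`P.IsHolCotangentAt₂ … 𝔣` and `P.HasFinComponent σ`), followed by `∀ (a′ b : (L⁺)ˣ)` and the glue's `hPin` body VERBATIM at `N = 2` (`μ := lam`, `a := a′`, `μA := μ`):
for characters `ξ′` of `[U(⟨a′⟩)]`, `ξ″` of `[U(⟨b⟩)]` and closed invariant `Q′`, `Q″ ≤ L²([U(H)], μ)` whose carriers are the closed `(a′,ξ′)`- resp. `(b,ξ″)`-theta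
spans along `ιA`, `Q′ ≠ ⊥ → P ≃ᵤ Q′ → P ≃ᵤ Q″ → Q′ = Q″`.

HONEST LABEL: HC_CM is proved only modulo the 7 printed citations (2 remaining: hLiu418 = stmt-HodgeConjecture-24832, h413 = stmt-HodgeConjecture-24833)
until rung 0 closes; this file asserts nothing (a named predicate; count-neutral).  In print the pin is [Liu2021, Thm. B.4 (2)] «`W` is unique up to
isomorphism» + Howe duality; in house it is assembled from same-label classes, archimedean signs, Hasse, seam transport, organ (I) and central characters.

## References
* [Liu2021] Y. Liu, Camb. J. Math. 9 (2021) = arXiv:2102.11518: App. B Thm. B.4 (1)(2) (p. 98), Cor. B.6 (1), (3) and proofs (p. 99); App. D proof of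
  Prop. D.4 (1) (p. 131 L8–27).
* [Wu2013] C. Wu, J. Number Theory 133 (2013), Thm. 5.1, Thm. 5.3.  [Dixmier1977] J. Dixmier, *C\*-algebras*, §5.4, §13.1.3.
-/

set_option autoImplicit false
-- the mandated namespace has the single-problem summit's repeated segment (`HodgeConjecture.HodgeConjecture`)
set_option linter.dupNamespace false

noncomputable section

open NumberField NumberField.InfinitePlace MeasureTheory IsDedekindDomain
open scoped Matrix ComplexOrder ENNReal Classical

namespace Summit.HodgeConjecture.HodgeConjecture.Cruxes.HLiu418.F0LD1ThetaSpanPinDefs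

open Literature.RepresentationTheory.CompactGroups
open _root_.MeasureTheory
open Literature.NumberTheory.Automorphic Literature.NumberTheory.Automorphic.UnitaryGroup
open Literature.NumberTheory.Automorphic.UnitaryGroup.CotangentForms
open Literature.NumberTheory.Automorphic.UnitaryCurveForms
open Literature.NumberTheory.Automorphic.IdeleClassGroup
open Literature.NumberTheory.Automorphic.Liu2021
open Literature.NumberTheory.Automorphic.Liu2021.Def411WeilCarriers
open Literature.NumberTheory.Automorphic.Liu2021.Def411WeilCarriersDoubling
open Literature.NumberTheory.GaloisRepresentations
open Literature.NumberTheory.GelbartRogawski1991 Literature.NumberTheory.GelbartRogawski1991.UnitaryDualPair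
open Literature.NumberTheory.Weil1964
open Literature.RepresentationTheory.Liu2021 Literature.RepresentationTheory.HarrisKudlaSweet1996
open Literature.NumberTheory.Rogawski1990

/-- **`ThetaSpanPin₂` — the UNITARY-CLASS PIN of theta spans, closed over the curve letters' frame** (ROAD O; in-house PREDICATE, asserted nowhere in this
file).  In the frame of the (A₂-P) letter (CM field `L`, `4 ≤ [L:ℚ]`, `ι`, scaled rational frame `formCongr c g (t • H) = diag dV` of signature `(1,1)` at `ι` and
definite at the other complex places, cone frame `𝔣`, label `lam` conjugate symplectic of weight one, line `a`, `χ ∈ Chi`, `σ` irreducible smooth with an injective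
`j : σ → ω(lam, ε_a, χ)_f ∘ (finAdelicCongr … g ht hg)⁻¹`, pinned adelic transport `↑(ιA k) = g_𝔸⁻¹ k g_𝔸`, `[U(diag dV)]` compact), for every discrete
`P` of Hodge type `(1,0)` at `ι` with finite component `σ`, every two lines `a′`, `b`, characters `ξ′` of `[U(⟨a′⟩)]`, `ξ″` of `[U(⟨b⟩)]` and closed invariant
subspaces `Q′`, `Q″` of `L²([U(H)], μ)` whose carriers are the closed `(a′, ξ′)`- resp. `(b, ξ″)`-theta spans along `ιA`: if `Q′ ≠ ⊥` and `P` is unitarily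
equivalent to both `Q′` and `Q″`, then `Q′ = Q″`.  Binder prefix = ★ `F0LD1ThetaRealisationOfB6.thetaRealisation₂_of_B6`'s `hAP` verbatim (less the `[U(H)]`-compactness
instance, derivable from the frame); tail = the `hPin` hypothesis of the ROAD O glue `F0LD1MeetsOfOrthogonalCopy` verbatim at `N = 2`; = the `hPin` binder of
LD1-p01 (g5)'s closer draft v2 token for token.  Printed shadow (Liu2021, App. B Thm. B.4 (2) «`W` unique up to isomorphism»,
proof of Cor. B.6 (3) p. 99) (Dixmier1977, §13.1.3: unitary equivalence). -/
def ThetaSpanPin₂ : Prop :=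
  ∀ (L : Type) [Field L] [NumberField L] [IsCMField L] (ι : L →+* ℂ) (H : Matrix (Fin 2) (Fin 2) L)
    (dV : Fin 2 → L) (hdV : ∀ i, IsCMField.complexConj L (dV i) = dV i) (hdV0 : ∀ i, dV i ≠ 0)
    (t : L) (ht : t ≠ 0) (g : GL (Fin 2) L)
    (hg : formCongr ((IsCMField.complexConj L : L ≃ₐ[↥(maximalRealSubfield L)] L) : L →+* L) g (t • H) = Matrix.diagonal dV),
    (∃ T : GL (Fin 2) ℂ, formCongr (starRingEnd ℂ) T ((Matrix.diagonal dV).map ι) = Matrix.diagonal ![(1 : ℂ), -1]) →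
    (∀ τ' : L →+* ℂ, InfinitePlace.mk τ' ≠ InfinitePlace.mk ι → ((Matrix.diagonal dV).map τ').PosDef) →
    4 ≤ Module.finrank ℚ L →
    ∀ (𝔣 : ConeFrame L H (cmPlace L ι))
      (μ : Measure (adelicGroupData (↥(maximalRealSubfield L)) L (IsCMField.complexConj L) 2 H).automorphicQuotient)
      [(adelicGroupData (↥(maximalRealSubfield L)) L (IsCMField.complexConj L) 2 H).IsAutomorphicMeasure μ]
      {n' : ℕ} (e₁ : Fin 2 × Fin 1 ≃ Fin n')
      (lam : Literature.NumberTheory.Automorphic.IdeleClassGroup L →ₜ* Circle) (hlam : IsConjugateSymplectic L lam), HasWeight L lam 1 →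
    ∀ (a : (↥(maximalRealSubfield L))ˣ) (χ : Chi (↥(maximalRealSubfield L)) L (IsCMField.complexConj L))
      (W : Type) [AddCommGroup W] [Module ℂ W]
      (σ : Representation ℂ (finAdelic (↥(maximalRealSubfield L)) L (IsCMField.complexConj L) 2 H) W),
      σ.IsIrreducible → σ.IsSmooth →
    ∀ j : σ.IntertwiningMap
        ((rhoVAtLine (↥(maximalRealSubfield L)) L (IsCMField.complexConj L) 2 e₁ (Matrix.diagonal dV)
            (complexConj_imagUnit L) (imagUnit_ne_zero L) (imagUnit_mul_self L) (realDiagonal_isSymm L dV hdV)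
            (isUnit_det_realDiagonal L dV hdV hdV0) (realDiagonal_map L dV hdV).symm
            (fun a => isCompatible_chiSplittingLine L e₁ dV hdV hdV0 (toHeckeCharacter L lam)
              (isUnitary_toHeckeCharacter L lam) ((isOscillatorChar_toHeckeCharacter_iff lam).mpr hlam)
              (TW (↥(maximalRealSubfield L)) a) (isSymm_TW (↥(maximalRealSubfield L)) a)
              (isUnit_det_TW (↥(maximalRealSubfield L)) a) (JW (↥(maximalRealSubfield L)) L a)
              (JW_eq (↥(maximalRealSubfield L)) L a)) a χ).comp
          (finAdelicCongr (↥(maximalRealSubfield L)) L (IsCMField.complexConj L) g ht hg).symm.toMonoidHom),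
      Function.Injective j →
    ∀ (ιA : (adelicGroupData (↥(maximalRealSubfield L)) L (IsCMField.complexConj L) 2 H).Adelic →*
        ↥(UnitaryGroup.adelic (↥(maximalRealSubfield L)) L (IsCMField.complexConj L) 2 (Matrix.diagonal dV))),
      (∀ k, ((ιA k : ↥(UnitaryGroup.adelic (↥(maximalRealSubfield L)) L (IsCMField.complexConj L) 2 (Matrix.diagonal dV))) :
            GL (Fin 2) (AdeleRing (𝓞 L) L)) =
          (toAdeleGL L g)⁻¹ * adelicVal (↥(maximalRealSubfield L)) L (IsCMField.complexConj L) 2 H k * toAdeleGL L g) →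
    ∀ [CompactSpace (↥(UnitaryGroup.adelic (↥(maximalRealSubfield L)) L (IsCMField.complexConj L) 2 (Matrix.diagonal dV)) ⧸
        (UnitaryGroup.toAdelic (↥(maximalRealSubfield L)) L (IsCMField.complexConj L) 2 (Matrix.diagonal dV)).range)],
    ∀ P : DiscreteAutomorphicRep (adelicGroupData (↥(maximalRealSubfield L)) L (IsCMField.complexConj L) 2 H) μ,
      P.IsHolCotangentAt₂ (IsCMField.complexConj_ne_one L) (UnitaryGroup.complexConj_smul_infinitePlace L) (cmPlace L ι) 𝔣 →
      P.HasFinComponent σ →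
    ∀ (a' b : (↥(maximalRealSubfield L))ˣ),
      letI : MeasurableSpace (↥(UnitaryGroup.adelic (↥(maximalRealSubfield L)) L (IsCMField.complexConj L) 1 (JW (↥(maximalRealSubfield L)) L a')) ⧸
        (UnitaryGroup.toAdelic (↥(maximalRealSubfield L)) L (IsCMField.complexConj L) 1 (JW (↥(maximalRealSubfield L)) L a')).range) := borel _
      haveI := normal_range_toAdelic_JW L a'
      letI : MeasurableSpace (↥(UnitaryGroup.adelic (↥(maximalRealSubfield L)) L (IsCMField.complexConj L) 1 (JW (↥(maximalRealSubfield L)) L b)) ⧸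
        (UnitaryGroup.toAdelic (↥(maximalRealSubfield L)) L (IsCMField.complexConj L) 1 (JW (↥(maximalRealSubfield L)) L b)).range) := borel _
      haveI := normal_range_toAdelic_JW L b
      ∀ (ξ' : PontryaginDual (↥(UnitaryGroup.adelic (↥(maximalRealSubfield L)) L (IsCMField.complexConj L) 1 (JW (↥(maximalRealSubfield L)) L a')) ⧸
          (UnitaryGroup.toAdelic (↥(maximalRealSubfield L)) L (IsCMField.complexConj L) 1 (JW (↥(maximalRealSubfield L)) L a')).range))
        (ξ'' : PontryaginDual (↥(UnitaryGroup.adelic (↥(maximalRealSubfield L)) L (IsCMField.complexConj L) 1 (JW (↥(maximalRealSubfield L)) L b)) ⧸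
          (UnitaryGroup.toAdelic (↥(maximalRealSubfield L)) L (IsCMField.complexConj L) 1 (JW (↥(maximalRealSubfield L)) L b)).range))
        (Q' Q'' : ContRepresentation.ClosedSubrep ((adelicGroupData (↥(maximalRealSubfield L)) L (IsCMField.complexConj L) 2 H).rightRegular μ)),
        (Q'.toSubmodule : Set ((adelicGroupData (↥(maximalRealSubfield L)) L (IsCMField.complexConj L) 2 H).L2 μ)) = closure (Submodule.span ℂ
            {v : (adelicGroupData (↥(maximalRealSubfield L)) L (IsCMField.complexConj L) 2 H).L2 μ | ∃ (hρ : HasThetaMajorants fun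
          (p : ↥(UnitaryGroup.adelic (↥(maximalRealSubfield L)) L (IsCMField.complexConj L) 2 (Matrix.diagonal dV)) ×
            ↥(UnitaryGroup.adelic (↥(maximalRealSubfield L)) L (IsCMField.complexConj L) 1 (JW (↥(maximalRealSubfield L)) L a')))
            (Φ : piSchwartzBruhat (↥(maximalRealSubfield L)) (Fin n')) =>
            pairRep (↥(maximalRealSubfield L)) L (IsCMField.complexConj L) 2 1 e₁ (Matrix.diagonal dV) (JW (↥(maximalRealSubfield L)) L a')
              (chiSplittingLine L e₁ dV hdV hdV0 (toHeckeCharacter L lam) (isUnitary_toHeckeCharacter L lam)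
                ((isOscillatorChar_toHeckeCharacter_iff lam).mpr hlam) (TW (↥(maximalRealSubfield L)) a')
                (isUnit_det_TW (↥(maximalRealSubfield L)) a') (JW (↥(maximalRealSubfield L)) L a') (JW_eq (↥(maximalRealSubfield L)) L a'))
              p Φ)
            (μW : Measure (↥(UnitaryGroup.adelic (↥(maximalRealSubfield L)) L (IsCMField.complexConj L) 1 (JW (↥(maximalRealSubfield L)) L a')) ⧸
              (UnitaryGroup.toAdelic (↥(maximalRealSubfield L)) L (IsCMField.complexConj L) 1 (JW (↥(maximalRealSubfield L)) L a')).range)) (_ : IsFiniteMeasure μW)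
            (_ : SMulInvariantMeasure ↥(UnitaryGroup.adelic (↥(maximalRealSubfield L)) L (IsCMField.complexConj L) 1 (JW (↥(maximalRealSubfield L)) L a'))
              (↥(UnitaryGroup.adelic (↥(maximalRealSubfield L)) L (IsCMField.complexConj L) 1 (JW (↥(maximalRealSubfield L)) L a')) ⧸
                (UnitaryGroup.toAdelic (↥(maximalRealSubfield L)) L (IsCMField.complexConj L) 1 (JW (↥(maximalRealSubfield L)) L a')).range) μW)
            (Ψ : piSchwartzBruhat (↥(maximalRealSubfield L)) (Fin n'))
            (hθ : MemLp (toQuotFun (adelicGroupData (↥(maximalRealSubfield L)) L (IsCMField.complexConj L) 2 H) fun x =>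
              (lineThetaKernelDatum L 2 e₁ dV hdV hdV0 lam hlam a' hρ).thetaLiftFun μW Ψ (charCM ξ') (ιA x)) 2 μ),
            v = MemLp.toLp _ hθ} : Set ((adelicGroupData (↥(maximalRealSubfield L)) L (IsCMField.complexConj L) 2 H).L2 μ)) →
        (Q''.toSubmodule : Set ((adelicGroupData (↥(maximalRealSubfield L)) L (IsCMField.complexConj L) 2 H).L2 μ)) = closure (Submodule.span ℂ
            {v : (adelicGroupData (↥(maximalRealSubfield L)) L (IsCMField.complexConj L) 2 H).L2 μ | ∃ (hρ : HasThetaMajorants fun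
          (p : ↥(UnitaryGroup.adelic (↥(maximalRealSubfield L)) L (IsCMField.complexConj L) 2 (Matrix.diagonal dV)) ×
            ↥(UnitaryGroup.adelic (↥(maximalRealSubfield L)) L (IsCMField.complexConj L) 1 (JW (↥(maximalRealSubfield L)) L b)))
            (Φ : piSchwartzBruhat (↥(maximalRealSubfield L)) (Fin n')) =>
            pairRep (↥(maximalRealSubfield L)) L (IsCMField.complexConj L) 2 1 e₁ (Matrix.diagonal dV) (JW (↥(maximalRealSubfield L)) L b)
              (chiSplittingLine L e₁ dV hdV hdV0 (toHeckeCharacter L lam) (isUnitary_toHeckeCharacter L lam)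
                ((isOscillatorChar_toHeckeCharacter_iff lam).mpr hlam) (TW (↥(maximalRealSubfield L)) b)
                (isUnit_det_TW (↥(maximalRealSubfield L)) b) (JW (↥(maximalRealSubfield L)) L b) (JW_eq (↥(maximalRealSubfield L)) L b))
              p Φ)
            (μW : Measure (↥(UnitaryGroup.adelic (↥(maximalRealSubfield L)) L (IsCMField.complexConj L) 1 (JW (↥(maximalRealSubfield L)) L b)) ⧸
              (UnitaryGroup.toAdelic (↥(maximalRealSubfield L)) L (IsCMField.complexConj L) 1 (JW (↥(maximalRealSubfield L)) L b)).range)) (_ : IsFiniteMeasure μW)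
            (_ : SMulInvariantMeasure ↥(UnitaryGroup.adelic (↥(maximalRealSubfield L)) L (IsCMField.complexConj L) 1 (JW (↥(maximalRealSubfield L)) L b))
              (↥(UnitaryGroup.adelic (↥(maximalRealSubfield L)) L (IsCMField.complexConj L) 1 (JW (↥(maximalRealSubfield L)) L b)) ⧸
                (UnitaryGroup.toAdelic (↥(maximalRealSubfield L)) L (IsCMField.complexConj L) 1 (JW (↥(maximalRealSubfield L)) L b)).range) μW)
            (Ψ : piSchwartzBruhat (↥(maximalRealSubfield L)) (Fin n'))
            (hθ : MemLp (toQuotFun (adelicGroupData (↥(maximalRealSubfield L)) L (IsCMField.complexConj L) 2 H) fun x =>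
              (lineThetaKernelDatum L 2 e₁ dV hdV hdV0 lam hlam b hρ).thetaLiftFun μW Ψ (charCM ξ'') (ιA x)) 2 μ),
            v = MemLp.toLp _ hθ} : Set ((adelicGroupData (↥(maximalRealSubfield L)) L (IsCMField.complexConj L) 2 H).L2 μ)) →
        Q'.toSubmodule ≠ ⊥ →
        ContRepresentation.AreUnitarilyEquivalent P.space.toContRep Q'.toContRep →
        ContRepresentation.AreUnitarilyEquivalent P.space.toContRep Q''.toContRep → Q' = Q''

end Summit.HodgeConjecture.HodgeConjecture.Cruxes.HLiu418.F0LD1ThetaSpanPinDefs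

end
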